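import Summits.CriticalPhenomena.Ising3DConformalLimit.Theorems.SynchronousCouplingRotationJoiningQualTools
import Summits.CriticalPhenomena.Ising3DConformalLimit.Theorems.SynchronousCouplingRotationJoiningEqualLawGluing
import Summits.CriticalPhenomena.Ising3DConformalLimit.Theorems.SynchronousCouplingRotationJoiningLipschitzExt
import Summits.CriticalPhenomena.Ising3DConformalLimit.Theorems.SynchronousCouplingRotationJoiningRateBootstrap
import Literature.Probability.Distributions.ChainOfCouplings

/-!
# Route `SynchronousCoupling`, crux `RotationJoining` (stmt-CriticalPhenomena-18763), line `SketchIdeator2`: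
`stub_qualitativeOfFDDIsotropy` — the splitting transfer

`Sig.stub_qualitativeOfFDDIsotropy : DilationJoiningsAxis3 → DilationJoiningsTilted → AsymptoticFDDIsotropy →
QualitativeRotationJoining` (card `rate-from-dilations-splitting`, "SplittingTransfer" with the qualitative
conclusion; with the landed `stub_rateBootstrap` it gives the card's `SplittingTransfer`).

Proof. Fix `μ`, `n ≥ 1`, `m`. Realise the chain of tilted-cell dilation couplings at scales `n, 3n, 9n, …` on the
path space `ℕ → SpinConfig (Site 3)` (Ionescu-Tulcea: `Literature.Probability.Distributions.exists_measure_map_pair_eq`)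
as a law `P`, and the axis chain as `Q`. For a block `u` of the window the normalised tilted block at scale `3ᵏn`
read at path coordinate `k` has `L²(P)`-increments `≤ √|C_T| (3ᵏn)^(-θ/2)` (the dilation joining), so it converges
in `L²(P)` to `X_u` with `‖tilt⁽ⁿ⁾_u(ω 0) − X_u‖₂ ≤ √|C_T| n^(-θ/2)/(1 − 3^(-θ/2))` (`stub_l2LimitOfGeometric`); same
for the axis chain, `Y_u` on `Q`. Enumerating the window, `ω ↦ (X_u(ω))_u` and `ω' ↦ (Y_u(ω'))_u` have the SAME law
on `ℝ^window`: both are limits of the block laws at scales `3ᵏn` (`stub_lipschitzTestConvergence`), whose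
bounded-Lipschitz statistics merge by `AsymptoticFDDIsotropy`, and bounded `1`-Lipschitz functions determine the law
(`stub_measureExtOfLipschitz`). Gluing `P` and `Q` along this common law (`stub_equalLawGluing`) and reading the two
paths at coordinate `0` gives a coupling of `μ` with `μ` whose per-block defect is, by Minkowski in `L²`, at most
`((√|C_T| + √|C_A|)/(1 − 3^(-θ/2)))² n^(-θ)` — uniformly in the window, since the dilation constants are.
-/

noncomputable section

namespace Summit.CriticalPhenomena.Ising3DConformalLimit.Cruxes.RotationJoining.RateSplitting

open MeasureTheory ProbabilityTheory Filter Topology Literature.Probability.LatticeModels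

/-- `x^(-θ) = (x^(-θ/2))²` for `x ≥ 0`. -/
theorem rpow_neg_eq_sq {x : ℝ} (hx : 0 ≤ x) (θ : ℝ) : x ^ (-θ) = (x ^ (-(θ / 2))) ^ 2 := by
  rw [← Real.rpow_natCast, ← Real.rpow_mul hx]
  congr 1
  push_cast
  ring

/-- A bounded measurable real function is in `L²` of a finite measure. -/
theorem memLp_two_of_bounded {Ω : Type*} [MeasurableSpace Ω] (μ : Measure Ω) [IsFiniteMeasure μ] {f : Ω → ℝ}
    (hf : Measurable f) (hb : ∃ B, ∀ x, |f x| ≤ B) : MemLp f 2 μ := by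
  obtain ⟨B, hB⟩ := hb
  exact MemLp.of_bound hf.aestronglyMeasurable B (ae_of_all _ fun x => by rw [Real.norm_eq_abs]; exact hB x)

/-- **Registered stub `stub_qualitativeOfFDDIsotropy`** (line `SketchIdeator2`, stub 3b of reshape 1): the two
dilation joinings and the rate-free finite-window isotropy of the limiting block process give the qualitative,
window-uniform rotation joining. -/
theorem stub_qualitativeOfFDDIsotropy : Sig.stub_qualitativeOfFDDIsotropy := by
  intro hAx hTi hIso μ hμ hTI ε hε
  haveI : IsProbabilityMeasure μ := IsGibbsMeasure.isProbabilityMeasure hμ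
  obtain ⟨CA, θA, hθA, hA⟩ := hAx μ hμ hTI
  obtain ⟨CT, θT, hθT, hT⟩ := hTi μ hμ hTI
  have hI := hIso μ hμ hTI
  choose πA hπA1 hπA2 hπA3 using hA
  choose πT hπT1 hπT2 hπT3 using hT
  -- the exponent and the constants
  set θ : ℝ := min θA θT with hθdef
  have hθ : 0 < θ := lt_min hθA hθT
  have hθA' : θ ≤ θA := min_le_left _ _
  have hθT' : θ ≤ θT := min_le_right _ _
  set r : ℝ := (3 : ℝ) ^ (-(θ / 2)) with hrdef
  have hr0 : 0 < r := Real.rpow_pos_of_pos (by norm_num) _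
  have hr1 : r < 1 := Real.rpow_lt_one_of_one_lt_of_neg (by norm_num) (by linarith)
  have h1r : 0 < 1 - r := by linarith
  set S : ℝ := (1 - r)⁻¹ with hSdef
  have hS0 : 0 < S := inv_pos.mpr h1r
  set K : ℝ := (Real.sqrt |CT| + Real.sqrt |CA|) * S with hKdef
  have hK0 : 0 ≤ K := by positivity
  -- choice of `N` (independent of the window): `K² n^(-θ) < ε` for `n ≥ N₀`
  have hKlim : Tendsto (fun n : ℕ => K ^ 2 * (n : ℝ) ^ (-θ)) atTop (𝓝 0) := by
    have h := ((tendsto_rpow_neg_atTop hθ).comp tendsto_natCast_atTop_atTop).const_mul (K ^ 2)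
    simpa using h
  obtain ⟨N₀, hN₀⟩ := Filter.eventually_atTop.1 (hKlim.eventually (gt_mem_nhds hε))
  refine ⟨max N₀ 1, fun n m hn => ?_⟩
  have hKn : K ^ 2 * (n : ℝ) ^ (-θ) < ε := hN₀ n (le_of_max_le_left hn)
  have hn1 : 1 ≤ n := le_of_max_le_right hn
  have hn0 : (0 : ℝ) < n := by exact_mod_cast hn1
  -- the scales `s k = 3ᵏ n`
  set s : ℕ → ℕ := fun k => 3 ^ k * n with hsdef
  have hs1 : ∀ k, 1 ≤ s k := fun k => one_le_mul (Nat.one_le_pow _ _ (by norm_num)) hn1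
  have hs3 : ∀ k, 3 * s k = s (k + 1) := fun k => by simp only [hsdef, pow_succ]; ring
  have hs0 : s 0 = n := by simp [hsdef]
  have hsR1 : ∀ k, (1 : ℝ) ≤ (s k : ℝ) := fun k => by exact_mod_cast hs1 k
  have hsR : ∀ k, ((s k : ℕ) : ℝ) ^ (-(θ / 2)) = (n : ℝ) ^ (-(θ / 2)) * r ^ k := fun k => scale_rpow n k θ
  have hs_tendsto : Tendsto s atTop atTop :=
    tendsto_atTop_mono (fun k => Nat.le_mul_of_pos_right _ hn1) (tendsto_pow_atTop_atTop_of_one_lt (by norm_num))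
  -- the block observables along the scales
  set tl : (Fin 3 → ℤ) → ℕ → SpinConfig (Site 3) → ℝ :=
    fun u k σ => normTilt μ (s k) m * blockSum (tiltCell (s k) m u) σ with htl
  set ax : (Fin 3 → ℤ) → ℕ → SpinConfig (Site 3) → ℝ :=
    fun u k σ => normAxis μ (s k) * blockSum (axisCell (s k) u) σ with hax
  have mtl : ∀ u k, Measurable (tl u k) := fun u k => measurable_const_mul_blockSum _ _
  have maxs : ∀ u k, Measurable (ax u k) := fun u k => measurable_const_mul_blockSum _ _
  have btl : ∀ u k, ∃ B, ∀ σ, |tl u k σ| ≤ B := fun u k => bounded_const_mul_blockSum _ _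
  have bax : ∀ u k, ∃ B, ∀ σ, |ax u k σ| ≤ B := fun u k => bounded_const_mul_blockSum _ _
  -- generic step: `I ≤ C x^(-θ')`, `x = s k ≥ 1`, `θ ≤ θ'` ⇒ `I ≤ (√|C| n^(-θ/2) rᵏ)²`
  have root : ∀ (I C θ' : ℝ) (k : ℕ), θ ≤ θ' → I ≤ C * ((s k : ℕ) : ℝ) ^ (-θ') →
      I ≤ (Real.sqrt |C| * (n : ℝ) ^ (-(θ / 2)) * r ^ k) ^ 2 := by
    intro I C θ' k hθ' hIle
    have h1 : I ≤ |C| * ((s k : ℕ) : ℝ) ^ (-θ) :=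
      calc I ≤ C * ((s k : ℕ) : ℝ) ^ (-θ') := hIle
        _ ≤ |C| * ((s k : ℕ) : ℝ) ^ (-θ') :=
            mul_le_mul_of_nonneg_right (le_abs_self C) (Real.rpow_nonneg (by positivity) _)
        _ ≤ |C| * ((s k : ℕ) : ℝ) ^ (-θ) :=
            mul_le_mul_of_nonneg_left (Real.rpow_le_rpow_of_exponent_le (hsR1 k) (by linarith)) (abs_nonneg C)
    have h2 : |C| * ((s k : ℕ) : ℝ) ^ (-θ) = (Real.sqrt |C| * (n : ℝ) ^ (-(θ / 2)) * r ^ k) ^ 2 := by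
      rw [rpow_neg_eq_sq (by positivity), hsR k,
        show (Real.sqrt |C| * (n : ℝ) ^ (-(θ / 2)) * r ^ k) ^ 2 =
          Real.sqrt |C| ^ 2 * ((n : ℝ) ^ (-(θ / 2)) * r ^ k) ^ 2 by ring,
        Real.sq_sqrt (abs_nonneg C)]
    exact h1.trans h2.le
  -- the chains of couplings on the path space
  set PTc : ℕ → Measure (SpinConfig (Site 3) × SpinConfig (Site 3)) :=
    fun k => (πT (s k) m (hs1 k)).map Prod.swap with hPTc
  set PAc : ℕ → Measure (SpinConfig (Site 3) × SpinConfig (Site 3)) :=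
    fun k => (πA (s k) m (hs1 k)).map Prod.swap with hPAc
  have hPTc1 : ∀ k, (PTc k).fst = μ := fun k => by simp only [hPTc]; rw [Measure.fst_map_swap, hπT2]
  have hPTc2 : ∀ k, (PTc k).snd = μ := fun k => by simp only [hPTc]; rw [Measure.snd_map_swap, hπT1]
  have hPAc1 : ∀ k, (PAc k).fst = μ := fun k => by simp only [hPAc]; rw [Measure.fst_map_swap, hπA2]
  have hPAc2 : ∀ k, (PAc k).snd = μ := fun k => by simp only [hPAc]; rw [Measure.snd_map_swap, hπA1]
  haveI : ∀ k, IsProbabilityMeasure (PTc k) := fun k => isProbabilityMeasure_of_fst_eq (hPTc1 k)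
  haveI : ∀ k, IsProbabilityMeasure (PAc k) := fun k => isProbabilityMeasure_of_fst_eq (hPAc1 k)
  obtain ⟨P, hPprob, hPpair⟩ :=
    Literature.Probability.Distributions.exists_measure_map_pair_eq PTc (fun k => by rw [hPTc1, hPTc2])
  obtain ⟨Q, hQprob, hQpair⟩ :=
    Literature.Probability.Distributions.exists_measure_map_pair_eq PAc (fun k => by rw [hPAc1, hPAc2])
  have hPev : ∀ k, P.map (fun x => x k) = μ := fun k => by rw [map_eval_of_map_pair P (PTc k) k (hPpair k), hPTc1]
  have hQev : ∀ k, Q.map (fun x => x k) = μ := fun k => by rw [map_eval_of_map_pair Q (PAc k) k (hQpair k), hPAc1]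
  -- the window and its enumeration
  set W : Finset (Fin 3 → ℤ) := Fintype.piFinset fun _ : Fin 3 => Finset.Icc (-(m : ℤ)) m with hW
  have hWmem : ∀ u : Fin 3 → ℤ, (∀ i, |u i| ≤ m) ↔ u ∈ W := by
    intro u
    simp only [hW, Fintype.mem_piFinset, Finset.mem_Icc, abs_le]
  set d : ℕ := W.card with hd
  set us : Fin d → (Fin 3 → ℤ) := fun i => (W.equivFin.symm i).1 with hus_def
  have hus : ∀ i l, |us i l| ≤ m := fun i => (hWmem _).2 (W.equivFin.symm i).2
  -- block observables of the window read along the chains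
  set ZT : Fin d → ℕ → (ℕ → SpinConfig (Site 3)) → ℝ := fun i k ω => tl (us i) k (ω k) with hZT
  set ZA : Fin d → ℕ → (ℕ → SpinConfig (Site 3)) → ℝ := fun i k ω => ax (us i) k (ω k) with hZA
  have mZT : ∀ i k, Measurable (ZT i k) := fun i k => (mtl _ _).comp (measurable_pi_apply k)
  have mZA : ∀ i k, Measurable (ZA i k) := fun i k => (maxs _ _).comp (measurable_pi_apply k)
  have bZT : ∀ i k, ∃ B, ∀ ω, |ZT i k ω| ≤ B := fun i k => by
    obtain ⟨B, hB⟩ := btl (us i) k; exact ⟨B, fun ω => hB _⟩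
  have bZA : ∀ i k, ∃ B, ∀ ω, |ZA i k ω| ≤ B := fun i k => by
    obtain ⟨B, hB⟩ := bax (us i) k; exact ⟨B, fun ω => hB _⟩
  -- `L²(P)`-increments of the tilted chain: the dilation joining for tilted cells
  set aT : ℝ := Real.sqrt |CT| * (n : ℝ) ^ (-(θ / 2)) with haT
  set aA : ℝ := Real.sqrt |CA| * (n : ℝ) ^ (-(θ / 2)) with haA
  have haT0 : 0 ≤ aT := by positivity
  have haA0 : 0 ≤ aA := by positivity
  have incrT : ∀ i k, ∫ ω, (ZT i (k + 1) ω - ZT i k ω) ^ 2 ∂P ≤ (aT * r ^ k) ^ 2 := by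
    intro i k
    have e1 : ∫ ω, (ZT i (k + 1) ω - ZT i k ω) ^ 2 ∂P =
        ∫ q, (tl (us i) (k + 1) q.2 - tl (us i) k q.1) ^ 2 ∂(PTc k) := by
      rw [← hPpair k, integral_map ((measurable_pi_apply k).prodMk (measurable_pi_apply (k + 1))).aemeasurable]
      exact (((mtl _ _).comp measurable_snd).sub ((mtl _ _).comp measurable_fst)).pow_const 2
        |>.aestronglyMeasurable
    have e2 : ∫ q, (tl (us i) (k + 1) q.2 - tl (us i) k q.1) ^ 2 ∂(PTc k) =
        ∫ q, (tl (us i) (k + 1) q.1 - tl (us i) k q.2) ^ 2 ∂(πT (s k) m (hs1 k)) := by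
      simp only [hPTc]
      rw [integral_map measurable_swap.aemeasurable]
      · rfl
      · exact (((mtl _ _).comp measurable_snd).sub ((mtl _ _).comp measurable_fst)).pow_const 2
          |>.aestronglyMeasurable
    rw [e1, e2]
    have hb := hπT3 (s k) m (hs1 k) (us i) (hus i)
    rw [hs3 k] at hb
    refine (root _ CT θT k hθT' ?_).trans (le_of_eq (by rw [haT]))
    simpa only [htl] using hb
  have incrA : ∀ i k, ∫ ω, (ZA i (k + 1) ω - ZA i k ω) ^ 2 ∂Q ≤ (aA * r ^ k) ^ 2 := by
    intro i k
    have e1 : ∫ ω, (ZA i (k + 1) ω - ZA i k ω) ^ 2 ∂Q =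
        ∫ q, (ax (us i) (k + 1) q.2 - ax (us i) k q.1) ^ 2 ∂(PAc k) := by
      rw [← hQpair k, integral_map ((measurable_pi_apply k).prodMk (measurable_pi_apply (k + 1))).aemeasurable]
      exact (((maxs _ _).comp measurable_snd).sub ((maxs _ _).comp measurable_fst)).pow_const 2
        |>.aestronglyMeasurable
    have e2 : ∫ q, (ax (us i) (k + 1) q.2 - ax (us i) k q.1) ^ 2 ∂(PAc k) =
        ∫ q, (ax (us i) (k + 1) q.1 - ax (us i) k q.2) ^ 2 ∂(πA (s k) m (hs1 k)) := by
      simp only [hPAc]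
      rw [integral_map measurable_swap.aemeasurable]
      · rfl
      · exact (((maxs _ _).comp measurable_snd).sub ((maxs _ _).comp measurable_fst)).pow_const 2
          |>.aestronglyMeasurable
    rw [e1, e2]
    have hb := hπA3 (s k) m (hs1 k) (us i) (hus i)
    rw [hs3 k] at hb
    refine (root _ CA θA k hθA' ?_).trans (le_of_eq (by rw [haA]))
    simpa only [hax] using hb
  -- `L²` limits along the chains
  choose X hXm hX2 hXb using fun i => stub_l2LimitOfGeometric P (ZT i) aT r haT0 hr0.le hr1 (mZT i) (bZT i) (incrT i)
  choose Y hYm hY2 hYb using fun i => stub_l2LimitOfGeometric Q (ZA i) aA r haA0 hr0.le hr1 (mZA i) (bZA i) (incrA i)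
  -- the limit vectors and the block vectors
  set XV : (ℕ → SpinConfig (Site 3)) → (Fin d → ℝ) := fun ω i => X i ω with hXV
  set YV : (ℕ → SpinConfig (Site 3)) → (Fin d → ℝ) := fun ω i => Y i ω with hYV
  set VT : ℕ → (ℕ → SpinConfig (Site 3)) → (Fin d → ℝ) := fun k ω i => ZT i k ω with hVT
  set VA : ℕ → (ℕ → SpinConfig (Site 3)) → (Fin d → ℝ) := fun k ω i => ZA i k ω with hVA
  have mXV : Measurable XV := measurable_pi_lambda _ fun i => hXm i
  have mYV : Measurable YV := measurable_pi_lambda _ fun i => hYm i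
  have mVT : ∀ k, Measurable (VT k) := fun k => measurable_pi_lambda _ fun i => mZT i k
  have mVA : ∀ k, Measurable (VA k) := fun k => measurable_pi_lambda _ fun i => mZA i k
  have hgeo : ∀ a : ℝ, Tendsto (fun k : ℕ => (a * r ^ k / (1 - r)) ^ 2) atTop (𝓝 0) := fun a => by
    have h := (((tendsto_pow_atTop_nhds_zero_of_lt_one hr0.le hr1).const_mul a).div_const (1 - r)).pow 2
    simpa using h
  have limT : ∀ i, Tendsto (fun k => ∫ ω, (VT k ω i - XV ω i) ^ 2 ∂P) atTop (𝓝 0) := fun i =>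
    squeeze_zero (fun k => integral_nonneg fun ω => sq_nonneg _) (fun k => hXb i k) (hgeo aT)
  have limA : ∀ i, Tendsto (fun k => ∫ ω, (VA k ω i - YV ω i) ^ 2 ∂Q) atTop (𝓝 0) := fun i =>
    squeeze_zero (fun k => integral_nonneg fun ω => sq_nonneg _) (fun k => hYb i k) (hgeo aA)
  -- the two limit vectors have the same law
  have hlaw : P.map XV = Q.map YV := by
    haveI : IsProbabilityMeasure (P.map XV) := Measure.isProbabilityMeasure_map mXV.aemeasurable
    haveI : IsProbabilityMeasure (Q.map YV) := Measure.isProbabilityMeasure_map mYV.aemeasurable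
    refine stub_measureExtOfLipschitz d _ _ fun f hf hfb => ?_
    obtain ⟨B, hB⟩ := hfb
    have hfm : Measurable f := hf.continuous.measurable
    rw [integral_map mXV.aemeasurable hfm.aestronglyMeasurable,
      integral_map mYV.aemeasurable hfm.aestronglyMeasurable]
    -- limits along the chains
    have cT : Tendsto (fun k => ∫ ω, f (VT k ω) ∂P) atTop (𝓝 (∫ ω, f (XV ω) ∂P)) :=
      stub_lipschitzTestConvergence P d VT XV mVT mXV
        (fun k i => memLp_two_of_bounded P (mZT i k) (bZT i k)) (fun i => hX2 i) limT f hf ⟨B, hB⟩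
    have cA : Tendsto (fun k => ∫ ω, f (VA k ω) ∂Q) atTop (𝓝 (∫ ω, f (YV ω) ∂Q)) :=
      stub_lipschitzTestConvergence Q d VA YV mVA mYV
        (fun k i => memLp_two_of_bounded Q (mZA i k) (bZA i k)) (fun i => hY2 i) limA f hf ⟨B, hB⟩
    -- the chain integrals are the lattice expectations at scale `s k`
    have idT : ∀ k, ∫ ω, f (VT k ω) ∂P =
        ∫ σ, f (fun i => normTilt μ (s k) m * blockSum (tiltCell (s k) m (us i)) σ) ∂μ := by
      intro k
      have hF : Measurable fun σ : SpinConfig (Site 3) =>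
          f (fun i => normTilt μ (s k) m * blockSum (tiltCell (s k) m (us i)) σ) :=
        hfm.comp (measurable_pi_lambda _ fun i => measurable_const_mul_blockSum _ _)
      have h := integral_map (μ := P) (φ := fun x : ℕ → SpinConfig (Site 3) => x k)
        (measurable_pi_apply k).aemeasurable hF.aestronglyMeasurable
      rw [hPev k] at h
      exact h.symm
    have idA : ∀ k, ∫ ω, f (VA k ω) ∂Q =
        ∫ σ, f (fun i => normAxis μ (s k) * blockSum (axisCell (s k) (us i)) σ) ∂μ := by
      intro k
      have hF : Measurable fun σ : SpinConfig (Site 3) =>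
          f (fun i => normAxis μ (s k) * blockSum (axisCell (s k) (us i)) σ) :=
        hfm.comp (measurable_pi_lambda _ fun i => measurable_const_mul_blockSum _ _)
      have h := integral_map (μ := Q) (φ := fun x : ℕ → SpinConfig (Site 3) => x k)
        (measurable_pi_apply k).aemeasurable hF.aestronglyMeasurable
      rw [hQev k] at h
      exact h.symm
    -- FDD isotropy along the scales `s k`
    have iso : Tendsto (fun k => ∫ ω, f (VT k ω) ∂P - ∫ ω, f (VA k ω) ∂Q) atTop (𝓝 0) := by
      refine ((hI d m us hus f hf ⟨B, hB⟩).comp hs_tendsto).congr fun k => ?_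
      rw [Function.comp_apply, idT k, idA k]
    have both : Tendsto (fun k => ∫ ω, f (VT k ω) ∂P - ∫ ω, f (VA k ω) ∂Q) atTop
        (𝓝 (∫ ω, f (XV ω) ∂P - ∫ ω, f (YV ω) ∂Q)) := cT.sub cA
    exact sub_eq_zero.1 (tendsto_nhds_unique both iso)
  -- glue the two path spaces along the common law
  obtain ⟨T, hT1, hT2, hTae⟩ := stub_equalLawGluing d P Q XV YV mXV mYV hlaw
  haveI : IsProbabilityMeasure T := isProbabilityMeasure_of_fst_eq hT1
  have hTfst : T.map Prod.fst = P := hT1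
  have hTsnd : T.map Prod.snd = Q := hT2
  -- the coupling of `μ` with `μ`: read both paths at coordinate `0`
  have hg : Measurable fun p : (ℕ → SpinConfig (Site 3)) × (ℕ → SpinConfig (Site 3)) => (p.1 0, p.2 0) :=
    ((measurable_pi_apply 0).comp measurable_fst).prodMk ((measurable_pi_apply 0).comp measurable_snd)
  refine ⟨T.map (fun p => (p.1 0, p.2 0)), ?_, ?_, fun u hu => ?_⟩
  · rw [Measure.fst, Measure.map_map measurable_fst hg]
    change Measure.map ((fun x : ℕ → SpinConfig (Site 3) => x 0) ∘ Prod.fst) T = μ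
    rw [← Measure.map_map (measurable_pi_apply 0) measurable_fst, hTfst, hPev 0]
  · rw [Measure.snd, Measure.map_map measurable_snd hg]
    change Measure.map ((fun x : ℕ → SpinConfig (Site 3) => x 0) ∘ Prod.snd) T = μ
    rw [← Measure.map_map (measurable_pi_apply 0) measurable_snd, hTsnd, hQev 0]
  · -- the block `u` is `us i`
    obtain ⟨i, hi⟩ : ∃ i, us i = u := ⟨W.equivFin ⟨u, (hWmem u).1 hu⟩, by simp [hus_def]⟩
    subst hi
    have m0 : Measurable fun q : SpinConfig (Site 3) × SpinConfig (Site 3) =>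
        (normTilt μ n m * blockSum (tiltCell n m (us i)) q.1 - normAxis μ n * blockSum (axisCell n (us i)) q.2) ^ 2 :=
      (((measurable_const_mul_blockSum _ _).comp measurable_fst).sub
        ((measurable_const_mul_blockSum _ _).comp measurable_snd)).pow_const 2
    rw [integral_map hg.aemeasurable m0.aestronglyMeasurable]
    have hfun : (fun p : (ℕ → SpinConfig (Site 3)) × (ℕ → SpinConfig (Site 3)) =>
        (normTilt μ n m * blockSum (tiltCell n m (us i)) (p.1 0) -
          normAxis μ n * blockSum (axisCell n (us i)) (p.2 0)) ^ 2) =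
        fun p => (ZT i 0 p.1 - ZA i 0 p.2) ^ 2 := by
      funext p
      simp only [hZT, hZA, htl, hax, hs0]
    rw [hfun]
    -- the four functions on the glued space
    have ma : MemLp (fun p : (ℕ → SpinConfig (Site 3)) × (ℕ → SpinConfig (Site 3)) => ZT i 0 p.1) 2 T :=
      memLp_two_of_bounded T ((mZT i 0).comp measurable_fst)
        (by obtain ⟨B, hB⟩ := bZT i 0; exact ⟨B, fun p => hB _⟩)
    have mc : MemLp (fun p : (ℕ → SpinConfig (Site 3)) × (ℕ → SpinConfig (Site 3)) => ZA i 0 p.2) 2 T :=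
      memLp_two_of_bounded T ((mZA i 0).comp measurable_snd)
        (by obtain ⟨B, hB⟩ := bZA i 0; exact ⟨B, fun p => hB _⟩)
    have mb : MemLp (fun p : (ℕ → SpinConfig (Site 3)) × (ℕ → SpinConfig (Site 3)) => X i p.1) 2 T :=
      (memLp_map_measure_iff (μ := T) (f := Prod.fst) (g := X i)
        (by rw [hTfst]; exact (hXm i).aestronglyMeasurable) measurable_fst.aemeasurable).1
        (by rw [hTfst]; exact hX2 i)
    have mb' : MemLp (fun p : (ℕ → SpinConfig (Site 3)) × (ℕ → SpinConfig (Site 3)) => Y i p.2) 2 T :=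
      (memLp_map_measure_iff (μ := T) (f := Prod.snd) (g := Y i)
        (by rw [hTsnd]; exact (hYm i).aestronglyMeasurable) measurable_snd.aemeasurable).1
        (by rw [hTsnd]; exact hY2 i)
    -- the two outer defects are the chain tail bounds at `k = 0`
    have dT : Real.sqrt (∫ p, (ZT i 0 p.1 - X i p.1) ^ 2 ∂T) ≤ aT * S := by
      have e : ∫ p, (ZT i 0 p.1 - X i p.1) ^ 2 ∂T = ∫ ω, (ZT i 0 ω - X i ω) ^ 2 ∂P := by
        rw [← hTfst, integral_map measurable_fst.aemeasurable]
        exact ((mZT i 0).sub (hXm i)).pow_const 2 |>.aestronglyMeasurable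
      rw [e]
      calc Real.sqrt (∫ ω, (ZT i 0 ω - X i ω) ^ 2 ∂P) ≤ Real.sqrt ((aT * r ^ 0 / (1 - r)) ^ 2) :=
            Real.sqrt_le_sqrt (hXb i 0)
        _ = aT * S := by rw [Real.sqrt_sq (by positivity), pow_zero, mul_one, hSdef, div_eq_mul_inv]
    have dA : Real.sqrt (∫ p, (Y i p.2 - ZA i 0 p.2) ^ 2 ∂T) ≤ aA * S := by
      have e : ∫ p, (Y i p.2 - ZA i 0 p.2) ^ 2 ∂T = ∫ ω, (ZA i 0 ω - Y i ω) ^ 2 ∂Q := by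
        rw [← hTsnd, integral_map measurable_snd.aemeasurable]
        · exact integral_congr_ae (ae_of_all _ fun p => by ring)
        · exact ((mZA i 0).sub (hYm i)).pow_const 2 |>.aestronglyMeasurable
      rw [e]
      calc Real.sqrt (∫ ω, (ZA i 0 ω - Y i ω) ^ 2 ∂Q) ≤ Real.sqrt ((aA * r ^ 0 / (1 - r)) ^ 2) :=
            Real.sqrt_le_sqrt (hYb i 0)
        _ = aA * S := by rw [Real.sqrt_sq (by positivity), pow_zero, mul_one, hSdef, div_eq_mul_inv]
    -- the middle defect vanishes: `X i p.1 = Y i p.2` a.e.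
    have hmid : ∫ p, (X i p.1 - ZA i 0 p.2) ^ 2 ∂T = ∫ p, (Y i p.2 - ZA i 0 p.2) ^ 2 ∂T := by
      refine integral_congr_ae ?_
      filter_upwards [hTae] with p hp
      have := congr_fun hp i
      simp only [hXV, hYV] at this
      rw [this]
    -- Minkowski
    have total : Real.sqrt (∫ p, (ZT i 0 p.1 - ZA i 0 p.2) ^ 2 ∂T) ≤ K * (n : ℝ) ^ (-(θ / 2)) :=
      calc Real.sqrt (∫ p, (ZT i 0 p.1 - ZA i 0 p.2) ^ 2 ∂T)
          ≤ Real.sqrt (∫ p, (ZT i 0 p.1 - X i p.1) ^ 2 ∂T) + Real.sqrt (∫ p, (X i p.1 - ZA i 0 p.2) ^ 2 ∂T) :=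
            sqrt_integral_sq_sub_le_of_memLp T ma mb mc
        _ ≤ aT * S + aA * S := by rw [hmid]; exact add_le_add dT dA
        _ = K * (n : ℝ) ^ (-(θ / 2)) := by rw [hKdef, haT, haA]; ring
    have hI0 : 0 ≤ ∫ p, (ZT i 0 p.1 - ZA i 0 p.2) ^ 2 ∂T := integral_nonneg fun p => sq_nonneg _
    have h1 : ∫ p, (ZT i 0 p.1 - ZA i 0 p.2) ^ 2 ∂T ≤ (K * (n : ℝ) ^ (-(θ / 2))) ^ 2 := by
      rw [← Real.sq_sqrt hI0]
      exact pow_le_pow_left₀ (Real.sqrt_nonneg _) total 2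
    have h2 : (K * (n : ℝ) ^ (-(θ / 2))) ^ 2 = K ^ 2 * (n : ℝ) ^ (-θ) := by
      rw [mul_pow, ← rpow_neg_eq_sq hn0.le]
    linarith [h1, h2.le, h2.ge, hKn]

end Summit.CriticalPhenomena.Ising3DConformalLimit.Cruxes.RotationJoining.RateSplitting

end
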